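import Mathlib

/-!
# Crux `OddMorawetzLocal` (stmt-NavierStokesRegularity-1376) — vocabulary of the symmetry reduction

Definitions (and their unfolding lemmas only) for the negative-knowledge files of the crux under
`Theorems/OddMorawetzLocal/Negative/`: the hyperoctahedral group `B₃` of the 48 signed coordinate permutations of
`ℝ³` (`signedPermLI 𝕜 σ ε`, for `𝕜 = ℝ` the isometries `x ↦ (i ↦ ε i · x (σ⁻¹ i))`, for `𝕜 = ℂ` the same matrices
acting on the range of vector Fourier transforms), the induced action on continuous `j`-multilinear maps and on
3-jets (`mlAct`, `jetAct`: the 3-jet of `g ∘ v ∘ g⁻¹` at `x` is `jetAct g` of the 3-jet of `v` at `g⁻¹ x`), and the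
`B₃`-average of a density (`b3Average`). Consumer: `OddMorawetzLocalB3Reduction.lean`
(`oddMorawetzLocal_iff_b3Invariant`: a witness of the crux may be taken `B₃`-invariant, which reduces the hunt at
each weight to an explicit finite-dimensional cone of orbit sums of monomials — the finite-group substitute for
isotropy, with no invariant theory). Plain definitions over Mathlib (`LinearIsometryEquiv`,
`ContinuousMultilinearMap.compContinuousLinearMapL`, `ContinuousLinearMap.compContinuousMultilinearMapL`).
-/

noncomputable section

set_option linter.dupNamespace false

namespace Summit.NavierStokesRegularity.NavierStokesRegularity.Theorems.OddMorawetz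

/-- The space of 3-jets `(u, ∇u, ∇²u, ∇³u)(x)` of a vector field on `ℝ³` (the argument of the crux's densities). -/
abbrev Jet3 := EuclideanSpace ℝ (Fin 3) × (EuclideanSpace ℝ (Fin 3) [×1]→L[ℝ] EuclideanSpace ℝ (Fin 3)) ×
  (EuclideanSpace ℝ (Fin 3) [×2]→L[ℝ] EuclideanSpace ℝ (Fin 3)) × (EuclideanSpace ℝ (Fin 3) [×3]→L[ℝ] EuclideanSpace ℝ (Fin 3))

/-- The signed coordinate permutation `x ↦ (i ↦ ε i · x (σ⁻¹ i))` of `𝕜³` (so `e_j ↦ ε (σ j) • e_{σ j}`), as a linear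
isometry equivalence; over `𝕜 = ℝ` the 48 pairs `(σ, ε)` form the hyperoctahedral group `B₃ ⊂ O(3)`, over `𝕜 = ℂ` the
same matrices act on the complexified range of Fourier transforms. -/
def signedPermLI (𝕜 : Type*) [RCLike 𝕜] (σ : Equiv.Perm (Fin 3)) (ε : Fin 3 → ℤˣ) :
    EuclideanSpace 𝕜 (Fin 3) ≃ₗᵢ[𝕜] EuclideanSpace 𝕜 (Fin 3) where
  toFun x := WithLp.toLp 2 fun i => ((ε i : ℤ) : 𝕜) * x (σ.symm i)
  invFun y := WithLp.toLp 2 fun j => ((ε (σ j) : ℤ) : 𝕜) * y (σ j)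
  map_add' x y := by
    ext i
    simp only [PiLp.add_apply]
    ring
  map_smul' c x := by
    ext i
    simp only [PiLp.smul_apply, smul_eq_mul, RingHom.id_apply]
    ring
  left_inv x := by
    ext j
    simp [← mul_assoc, ← Int.cast_mul]
  right_inv y := by
    ext i
    simp [← mul_assoc, ← Int.cast_mul]
  norm_map' x := by
    have hε : ∀ i, ‖((ε i : ℤ) : 𝕜)‖ = 1 := by
      intro i
      rcases Int.units_eq_one_or (ε i) with h | h <;> simp [h]
    change ‖(WithLp.toLp 2 fun i => ((ε i : ℤ) : 𝕜) * x (σ.symm i) : EuclideanSpace 𝕜 (Fin 3))‖ = ‖x‖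
    rw [EuclideanSpace.norm_eq, EuclideanSpace.norm_eq]
    congr 1
    calc (∑ i, ‖(WithLp.toLp 2 fun i => ((ε i : ℤ) : 𝕜) * x (σ.symm i) : EuclideanSpace 𝕜 (Fin 3)) i‖ ^ 2)
          = ∑ i, ‖x (σ.symm i)‖ ^ 2 := by
            refine Finset.sum_congr rfl fun i _ => ?_
            rw [PiLp.toLp_apply, norm_mul, hε i, one_mul]
      _ = ∑ j, ‖x j‖ ^ 2 := Equiv.sum_comp σ.symm (fun j => ‖x j‖ ^ 2)

/-- Coordinates of a signed coordinate permutation. -/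
@[simp] theorem signedPermLI_apply (𝕜 : Type*) [RCLike 𝕜] (σ : Equiv.Perm (Fin 3)) (ε : Fin 3 → ℤˣ)
    (x : EuclideanSpace 𝕜 (Fin 3)) (i : Fin 3) :
    signedPermLI 𝕜 σ ε x i = ((ε i : ℤ) : 𝕜) * x (σ.symm i) := rfl

/-- Coordinates of the inverse signed coordinate permutation. -/
@[simp] theorem signedPermLI_symm_apply (𝕜 : Type*) [RCLike 𝕜] (σ : Equiv.Perm (Fin 3)) (ε : Fin 3 → ℤˣ)
    (y : EuclideanSpace 𝕜 (Fin 3)) (j : Fin 3) :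
    (signedPermLI 𝕜 σ ε).symm y j = ((ε (σ j) : ℤ) : 𝕜) * y (σ j) := rfl

/-- The real signed coordinate permutations (the group `B₃` acting on `ℝ³`). -/
abbrev signedPerm (σ : Equiv.Perm (Fin 3)) (ε : Fin 3 → ℤˣ) : (EuclideanSpace ℝ (Fin 3)) ≃ₗᵢ[ℝ] (EuclideanSpace ℝ (Fin 3)) := signedPermLI ℝ σ ε

/-- The induced action of a linear isometry `g` of `ℝ³` on continuous `j`-multilinear maps `ℝ³ × ⋯ × ℝ³ → ℝ³`:
`A ↦ g ∘ A ∘ (g⁻¹, …, g⁻¹)` (how the `j`-th derivative of a vector field transforms under `v ↦ g ∘ v ∘ g⁻¹`). -/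
def mlAct (g : (EuclideanSpace ℝ (Fin 3)) ≃ₗᵢ[ℝ] (EuclideanSpace ℝ (Fin 3))) (j : ℕ) : ((EuclideanSpace ℝ (Fin 3)) [×j]→L[ℝ] (EuclideanSpace ℝ (Fin 3))) →L[ℝ] ((EuclideanSpace ℝ (Fin 3)) [×j]→L[ℝ] (EuclideanSpace ℝ (Fin 3))) :=
  (ContinuousLinearMap.compContinuousMultilinearMapL ℝ (fun _ : Fin j => (EuclideanSpace ℝ (Fin 3))) (EuclideanSpace ℝ (Fin 3)) (EuclideanSpace ℝ (Fin 3))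
      ((g : (EuclideanSpace ℝ (Fin 3)) →L[ℝ] (EuclideanSpace ℝ (Fin 3))))).comp
    (ContinuousMultilinearMap.compContinuousLinearMapL (fun _ : Fin j => ((g.symm : (EuclideanSpace ℝ (Fin 3)) ≃ₗᵢ[ℝ] (EuclideanSpace ℝ (Fin 3))) : (EuclideanSpace ℝ (Fin 3)) →L[ℝ] (EuclideanSpace ℝ (Fin 3)))))

/-- The action of a linear isometry of `ℝ³` on 3-jets (componentwise `mlAct`), so that the 3-jet of `g ∘ v ∘ g⁻¹` at
`x` is `jetAct g` of the 3-jet of `v` at `g⁻¹ x`. -/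
def jetAct (g : (EuclideanSpace ℝ (Fin 3)) ≃ₗᵢ[ℝ] (EuclideanSpace ℝ (Fin 3))) : Jet3 →L[ℝ] Jet3 :=
  (g : (EuclideanSpace ℝ (Fin 3)) →L[ℝ] (EuclideanSpace ℝ (Fin 3))).prodMap ((mlAct g 1).prodMap ((mlAct g 2).prodMap (mlAct g 3)))

/-- The average of a density over the hyperoctahedral group `B₃` (48 signed coordinate permutations). -/
def b3Average (m : Jet3 → ℝ) : Jet3 → ℝ := fun z =>
  (48 : ℝ)⁻¹ * ∑ p : Equiv.Perm (Fin 3) × (Fin 3 → ℤˣ), m (jetAct (signedPerm p.1 p.2) z)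

/-- `mlAct` unfolded. -/
theorem mlAct_apply (g : (EuclideanSpace ℝ (Fin 3)) ≃ₗᵢ[ℝ] (EuclideanSpace ℝ (Fin 3))) (j : ℕ) (A : (EuclideanSpace ℝ (Fin 3)) [×j]→L[ℝ] (EuclideanSpace ℝ (Fin 3))) (h : Fin j → (EuclideanSpace ℝ (Fin 3))) :
    mlAct g j A h = g (A fun i => g.symm (h i)) := by
  simp [mlAct]

/-- `jetAct` unfolded. -/
theorem jetAct_apply (g : (EuclideanSpace ℝ (Fin 3)) ≃ₗᵢ[ℝ] (EuclideanSpace ℝ (Fin 3))) (z : Jet3) :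
    jetAct g z = (g z.1, mlAct g 1 z.2.1, mlAct g 2 z.2.2.1, mlAct g 3 z.2.2.2) := by
  rcases z with ⟨z0, z1, z2, z3⟩
  rfl


end Summit.NavierStokesRegularity.NavierStokesRegularity.Theorems.OddMorawetz
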